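import Summits.BirchSwinnertonDyer.Rank1Residual.X11b.KolyvaginHpointsAssembly
import HarnessLib

/-!
# Leaf (A′) ASSEMBLED at concrete currency AT ONE PRIME `p`, WITH the global divisibility of the
# Kolyvagin classes threaded through: the `hpoints` binder of
# `KolyvaginOrder.card_sha_primary_le_at_of_pointsMDiv_of_reciprocityFinset_of_localDuality`
# (cell `bsd-stepL`, seat `bsd-stepL-tam3-p1` g9, crux stmt-BirchSwinnertonDyer-19109; sibling of
# x11b3-p2's `X11b/KolyvaginHpointsAssemblyAt`, cell `b2b-bsdres`)

HONEST FRAMING: **plumbing — an ASSEMBLY, not a discharge**; ONE THEOREM (no definition, no named fact,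
no `sorry`); nothing booked; no mark / label / count / tier moves; BSD is not proved for any curve. This is
x11b3-p2's `KolyvaginAssembly.hpoints_at_of_perLevelChoice` VERBATIM (same witnesses `ε := −w(E)`,
`τ := liftAut c`, `A_m := E(K[lev m])`, `P_m := P(lev m)` on the coherent tower, same labelled inputs
`hrec`, `hCM`, `h53`, `hGZ`, `hγ` at `p`) with ONE MORE labelled input and ONE MORE output clause:
* `hDivT` — **global divisibility to depth `t` of the derived Heegner points, class form**: for every
  frame `(Dt, β, ι)`, level `M ≥ 1`, square-free product `n` of Kolyvagin primes of `(p, M)` and tower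
  `d` of Kolyvagin–Heegner data below `n`, the class `c_M(n)` of the top datum is killed by `p^{M−t}`
  (`((p : ℤ) ^ (M - t)) • (d n dvd_rfl).kolyvaginClass hp M = 0`; for `M ≤ t` this says `c_M(n) = 0`).
  For the Heegner datum this is `P_n ∈ p^{min(M,t)} E(K_n)` (McCallum (5)–(6), Cor. 4.5), i.e. the
  hypothesis of the named fact `McCallum1991_padicValNat_card_sha_primary_add_le_of_globalDivisibility`
  (global divisibility to depth `t`, Jetchev 2008 (1)) read at the levels of `(p, M)`;
* output clause (g): `((p : ℤ) ^ (M - t)) • c(P_m) = 0` for the assembled class of `P_m`, which IS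
  McCallum's class of the top datum (`KolyvaginHeegnerData.kolyvaginClass_of_admissible`, as in the
  sibling's `hcl`).
Everything else — witnesses, clauses (a)–(f), their sources — is the sibling's, token for token.

What is proved: **`KolyvaginAssembly.hpoints_at_of_perLevelChoice_of_divT`** — the `hpoints` binder of
`KolyvaginOrder.card_sha_primary_le_at_of_pointsMDiv_of_reciprocityFinset_of_localDuality` (this seat's
`X11b/KolyvaginShaOrderOfPointsDivisible`) from {`hrec`, `hCM`, `h53`, `hGZ`, `hγ`, `hDivT`} at `p`.

References: [GrossLMS1991] §3, Prop. 3.7, §4 (4.1), Lemma 4.3, Props. 5.3, 5.4 (1), 6.2 (1);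
[McCallumLMS1991] §1 Theorem, §4 (4)–(6), Cor. 4.5, §5 Cor. 5.6; [Jetchev2008] p. 812 (1), Cor. 1.5;
[GrossZagier1986] III (3.1); [Darmon2004] Thm. 3.7, Prop. 3.11.
-/

noncomputable section

open scoped Classical
open WeierstrassCurve Field NumberField IsDedekindDomain Finset
open Literature.NumberTheory.EllipticCurves Literature.NumberTheory.GaloisRepresentations
open Literature.NumberTheory.EllipticCurves.KolyvaginCocycle
open Literature.NumberTheory.EllipticCurves.KolyvaginEuler
open Literature.NumberTheory.EllipticCurves.RingClassField
open Literature.NumberTheory.EllipticCurves.ModularForms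

namespace Summit.BirchSwinnertonDyer.Rank1Residual.X11b.KolyvaginAssembly

-- `K : Type`: the tree's ring-class class field theory is universe `0`.
variable {K : Type} [Field K] [NumberField K] {N : ℕ} {W : WeierstrassCurve ℚ}

/-- **Leaf (A′) AT ONE PRIME with global divisibility to depth `t` — the `hpoints` binder of
`KolyvaginOrder.card_sha_primary_le_at_of_pointsMDiv_of_reciprocityFinset_of_localDuality` — ASSEMBLED
at concrete currency by per-level choice** (x11b3-p2's `hpoints_at_of_perLevelChoice` VERBATIM plus the
labelled input `hDivT` and the output clause (g) `p^{M−t} · c(P_m) = 0`; module docstring). CONDITIONAL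
on the six labelled inputs; ASSEMBLY, not a discharge; nothing booked.
[cite: GrossLMS1991, §3, Prop. 3.7 (2), §4 (4.1), Lemma 4.3, Props. 5.3, 5.4 (1), 6.2 (1)]
[cite: McCallumLMS1991, §1 Theorem (Kolyvagin), §4 (4)–(6), Cor. 4.5, Lemma 4.3, Prop. 4.4]
[cite: Jetchev2008, p. 812 (1) and Cor. 1.5] [cite: GrossZagier1986, III (3.1)] [cite: Darmon2004, Thm. 3.7, Prop. 3.11] -/
theorem hpoints_at_of_perLevelChoice_of_divT [NeZero N] [W.IsGloballyMinimal] [W.IsElliptic]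
    (hN : N = W.conductorNorm ℤ) (hK : IsImaginaryQuadratic K)
    (hD34 : NumberField.discr K ≠ -3 ∧ NumberField.discr K ≠ -4)
    (hH : SatisfiesHeegnerHypothesis N K) {P : (W.baseChange K).toAffine.Point}
    (hHP : IsHeegnerPoint N W K P) {p : ℕ} (hp : p.Prime) (hp2 : p ≠ 2)
    (hρ : W.HasSurjectiveModNGaloisRep p)
    (hrec : heegnerPointOfConductor_one_galoisConj N W K)
    (hCM : ∀ [W.IsElliptic] (_hK : IsImaginaryQuadratic K) (_hH : SatisfiesHeegnerHypothesis N K)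
      (Dt : ModularParametrizationData W N) (β : ℤ) (ι : K →+* ℂ),
      (4 * N : ℤ) ∣ β ^ 2 - NumberField.discr K →
      ∀ {M : ℕ}, 1 ≤ M → ∀ (m : ℕ), Squarefree m →
      (∀ q ∈ m.primeFactors, IsKolyvaginPrime N W K p q ∧ FrobEqFrobInfty W K (p ^ M) q) →
      ∃ y : (W.baseChange (ringClassField K ι m)).toAffine.Point,
        WeierstrassCurve.Affine.Point.map (W' := W) (ringClassField K ι m).subtype.toRatAlgHom y =
          heegnerPointComplexOfConductor Dt (NumberField.discr K) β m)
    (h53 : ∀ [W.IsElliptic] (_hK : IsImaginaryQuadratic K) (_hH : SatisfiesHeegnerHypothesis N K)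
      (Dt : ModularParametrizationData W N) (β : ℤ) (ι : K →+* ℂ) {M : ℕ}
      (_hM : 1 ≤ M) {n : ℕ} (_hn : Squarefree n)
      (_hKol : ∀ q ∈ n.primeFactors, IsKolyvaginPrime N W K p q ∧ FrobEqFrobInfty W K (p ^ M) q)
      (d : (m : ℕ) → m ∣ n → KolyvaginHeegnerData Dt β ι m) (m : ℕ) (hm : m ∣ n)
      (τm : ringClassField K ι m ≃ₐ[ℚ] ringClassField K ι m),
      (∀ x : ringClassField K ι m, ((τm x : ringClassField K ι m) : ℂ) = starRingEnd ℂ x) →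
      ∃ σ' ∈ ringClassGal ι m, IsOfFinAddOrder
        (pointGalHom W (ringClassField K ι m) τm (d m hm).y -
          (-W.rootNumber) • pointGalHom W (ringClassField K ι m) σ' (d m hm).y))
    (hGZ : ∀ [W.IsElliptic] (_hK : IsImaginaryQuadratic K) (_hH : SatisfiesHeegnerHypothesis N K)
      (Dt : ModularParametrizationData W N) (β : ℤ) (ι : K →+* ℂ) {M : ℕ} (_hM : 1 ≤ M) {n : ℕ}
      (_hn : Squarefree n)
      (_hKol : ∀ q ∈ n.primeFactors, IsKolyvaginPrime N W K p q ∧ FrobEqFrobInfty W K (p ^ M) q)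
      (d : (m : ℕ) → m ∣ n → KolyvaginHeegnerData Dt β ι m),
      ∃ n' : ℤ, IsCoprime ((p ^ M : ℕ) : ℤ) n' ∧
        ∀ (m : ℕ) (hm : m ∣ n) (γ : ringClassField K ι m ≃ₐ[ℚ] ringClassField K ι m),
          γ ∈ ringClassGal ι m → ∀ v : HeightOneSpectrum (𝓞 K),
            ¬ (W.baseChange K).HasGoodReductionAt v →
            n' • pointsMap (W.baseChange K) (v.adicCompletion K)
                ((d m hm).toGeomPoints (pointGalHom W (ringClassField K ι m) γ (d m hm).y)) ∈
              E0Receptacle (W.baseChange K) v ∧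
            ∀ (ℓ : ℕ) (hℓ : ℓ ∈ m.primeFactors)
              (hle : ringClassField K ι (m / ℓ) ≤ ringClassField K ι m),
              n' • pointsMap (W.baseChange K) (v.adicCompletion K)
                  ((d m hm).toGeomPoints (pointGalHom W (ringClassField K ι m) γ
                    (WeierstrassCurve.Affine.Point.map (W' := W)
                      ((RingClassField.inclusion ι hle).restrictScalars ℚ)
                      (d (m / ℓ)
                        ((Nat.div_dvd_of_dvd (Nat.dvd_of_mem_primeFactors hℓ)).trans hm)).y))) ∈
                E0Receptacle (W.baseChange K) v)
    (hγ : ∀ [W.IsElliptic] (_hK : IsImaginaryQuadratic K) (_hH : SatisfiesHeegnerHypothesis N K)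
      (Dt : ModularParametrizationData W N) (β : ℤ) (ι : K →+* ℂ) {M : ℕ}
      (_hM : 1 ≤ M) {n : ℕ} (_hn : Squarefree n)
      (_hKol : ∀ q ∈ n.primeFactors, IsKolyvaginPrime N W K p q ∧ FrobEqFrobInfty W K (p ^ M) q)
      (d : (m : ℕ) → m ∣ n → KolyvaginHeegnerData Dt β ι m)
      (m : ℕ) (hm : m ∣ n) (ℓ : ℕ) (hℓ : ℓ ∈ m.primeFactors) [Fact ℓ.Prime]
      (hΔ : ¬ (ℓ : ℤ) ∣ minimalDiscriminantInt W) (φ₀ : absoluteGaloisGroup (ZMod ℓ)),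
      (∀ x : AlgebraicClosure (ZMod ℓ), φ₀ • x = x ^ ℓ) →
      ∀ (hle : ringClassField K ι (m / ℓ) ≤ ringClassField K ι m)
        (γ : ringClassField K ι m ≃ₐ[ℚ] ringClassField K ι m), γ ∈ ringClassGal ι m →
        geomReduction hΔ ((RatClosure.pointsEquiv (K := K) W).symm
            ((d m hm).toGeomPoints (pointGalHom W (ringClassField K ι m) γ (d m hm).y))) =
          φ₀ • geomReduction hΔ ((RatClosure.pointsEquiv (K := K) W).symm
            ((d m hm).toGeomPoints (pointGalHom W (ringClassField K ι m) γ
              (WeierstrassCurve.Affine.Point.map (W' := W)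
                ((RingClassField.inclusion ι hle).restrictScalars ℚ)
                (d (m / ℓ)
                  ((Nat.div_dvd_of_dvd (Nat.dvd_of_mem_primeFactors hℓ)).trans hm)).y)))))
    (t : ℕ)
    (hDivT : ∀ [W.IsElliptic] (_hK : IsImaginaryQuadratic K) (_hH : SatisfiesHeegnerHypothesis N K)
      (Dt : ModularParametrizationData W N) (β : ℤ) (ι : K →+* ℂ) {M : ℕ}
      (_hM : 1 ≤ M) {n : ℕ} (_hn : Squarefree n)
      (_hKol : ∀ q ∈ n.primeFactors, IsKolyvaginPrime N W K p q ∧ FrobEqFrobInfty W K (p ^ M) q)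
      (d : (m : ℕ) → m ∣ n → KolyvaginHeegnerData Dt β ι m),
      ((p : ℤ) ^ (M - t)) • (d n dvd_rfl).kolyvaginClass hp M = 0) :
    ∀ {M : ℕ} (_hM : 1 ≤ M)
      (hdiv : ∀ Q : geomPoints (W.baseChange K), ∃ R, ((p ^ M : ℕ) : ℤ) • R = Q)
      (c : K ≃ₐ[ℚ] K) (_hc : c ≠ 1),
      ∃ (ε : ℤ) (τ : AlgebraicClosure K ≃+* AlgebraicClosure K) (hτ : IsLiftOfAut c τ)
        (A : ℕ → AddSubgroup (geomPoints (W.baseChange K)))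
        (hA : ∀ m, KolyvaginCocycle.IsAdmissible (Field.absoluteGaloisGroup K) (A m)
          ((p ^ M : ℕ) : ℤ))
        (Pt : ℕ → geomPoints (W.baseChange K))
        (hPt : ∀ m, Pt m ∈
          KolyvaginCocycle.invPoints (Field.absoluteGaloisGroup K) (A m) ((p ^ M : ℕ) : ℤ)),
        (ε = 1 ∨ ε = -1) ∧
        IsOfFinAddOrder (Affine.Point.map (W' := W) (c : K →ₐ[ℚ] K) P - ε • P) ∧
        (∀ m, ∀ a ∈ A m, hτ.pointsMap W a ∈ A m) ∧
        Pt 1 = toGeomPoints (W.baseChange K) P ∧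
        (∀ m : ℕ, Squarefree m →
          (∀ q ∈ m.primeFactors, IsKolyvaginPrime N W K p q ∧ FrobEqFrobInfty W K (p ^ M) q) →
          (∃ B ∈ A m, hτ.pointsMap W (Pt m) =
            (ε * (-1) ^ m.primeFactors.card) • Pt m + ((p ^ M : ℕ) : ℤ) • B) ∧
          (∀ v : HeightOneSpectrum (𝓞 K), (m : 𝓞 K) ∉ v.asIdeal →
            kolyvaginClass (W.baseChange K) _ hdiv (hA m) (Pt m) (hPt m) ∈
              selmerLocalKer (W.baseChange K) (v.adicCompletion K) ((p ^ M : ℕ) : ℤ)) ∧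
          (∀ ℓ : ℕ, ℓ.Prime → ℓ ∣ m → ∀ v : HeightOneSpectrum (𝓞 K), (ℓ : 𝓞 K) ∈ v.asIdeal →
            ∀ a : ℕ, (((p : ℤ) ^ a) •
                kolyvaginClass (W.baseChange K) _ hdiv (hA m) (Pt m) (hPt m) ∈
                selmerLocalKer (W.baseChange K) (v.adicCompletion K) ((p ^ M : ℕ) : ℤ) ↔
              ((p : ℤ) ^ a) • kolyvaginClass (W.baseChange K) _ hdiv (hA (m / ℓ)) (Pt (m / ℓ))
                  (hPt (m / ℓ)) ∈
                (W.baseChange K).torsionLocalKer (v.adicCompletion K) ((p ^ M : ℕ) : ℤ))) ∧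
          ((p : ℤ) ^ (M - t)) • kolyvaginClass (W.baseChange K) _ hdiv (hA m) (Pt m) (hPt m) = 0) := by
  intro M hM hdiv c hc
  have hD : NumberField.discr K < -4 := discr_lt_neg_four hK hD34
  have hND := isCoprime_discr_of_satisfiesHeegnerHypothesis hK hH
  -- the frame `(Dt, β, ι)` of the consumer's Heegner point (x11b3-p1), with clause (c) on it
  obtain ⟨Dt, β, ι, hβ, hc1⟩ := KolyvaginBottom.exists_frame_of_isHeegnerPoint hrec hK hH hHP
  let Kol : ℕ → Prop := fun m ↦ Squarefree m ∧
    ∀ q ∈ m.primeFactors, IsKolyvaginPrime N W K p q ∧ FrobEqFrobInfty W K (p ^ M) q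
  let lev : ℕ → ℕ := fun m ↦ if Kol m then m else 1
  have hKol1 : Kol 1 := ⟨squarefree_one, by simp⟩
  have hlev : ∀ m, Kol (lev m) := fun m ↦ by
    by_cases h : Kol m <;> simp only [lev, if_pos, if_neg, h, hKol1, not_false_eq_true]
  have hlev_eq : ∀ m, Kol m → lev m = m := fun m h ↦ if_pos h
  have hlev0 : ∀ m, lev m ≠ 0 := fun m ↦ Squarefree.ne_zero (hlev m).1
  have hinert : ∀ m, ∀ q ∈ (lev m).primeFactors, (Ideal.span {(q : 𝓞 K)}).IsPrime :=
    fun m q hq ↦ ((hlev m).2 q hq).1.2.2.2.2.1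
  have hKdiv : ∀ (m k : ℕ), k ∣ lev m → Kol k := fun m k hk ↦ ⟨(hlev m).1.squarefree_of_dvd hk,
    fun q hq ↦ (hlev m).2 q (Nat.primeFactors_mono hk (hlev0 m) hq)⟩
  -- CM data `y(k) ∈ E(K[k])` at the divisors of every `lev m` (labelled input `hCM` at `p`)
  have hy0 : ∀ (m k : ℕ), k ∣ lev m → ∃ y : (W.baseChange (ringClassField K ι k)).toAffine.Point,
      WeierstrassCurve.Affine.Point.map (W' := W) (ringClassField K ι k).subtype.toRatAlgHom y =
        heegnerPointComplexOfConductor Dt (NumberField.discr K) β k :=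
    fun m k hk ↦ hCM hK hH Dt β ι hβ hM k (hKdiv m k hk).1 (hKdiv m k hk).2
  choose y hy using hy0
  -- the coherent tower with top `lev m` (x11b3-p8) — ONE choice per level
  choose T hTy hTord hTσ hTβ1 hTgeom hTcoh using fun m ↦
    RingClassTower.exists_coherent_kolyvaginHeegnerData Dt hK ι (n := lev m) (hlev m).1
      (hinert m) hβ (y m) (hy m)
  have hKolT := fun m ↦ (hlev m).2
  -- admissibility of every `E(K[k]) ⊆ E(K̄)` in the towers: the image binder is FREE (x11b3-p3)
  have hA : ∀ (m k : ℕ) (hk : k ∣ lev m),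
      IsAdmissible (absoluteGaloisGroup K) (T m k hk).pointsSubgroup ((p ^ M : ℕ) : ℤ) :=
    fun m ↦ RingClassNoTorsion.isAdmissible_pointsSubgroup_of_dvd hK (hlev0 m) (T m) hp hp2 hρ M
  -- `hPt` (McCallum (4), x11b3-p4) and `hI` (L4.3 inertia) at the level data of `exists_levelData`
  have hPtI : ∀ m : ℕ,
      (∀ (k : ℕ) (hk : k ∣ lev m),
        (T m k hk).toGeomPoints (T m k hk).derivedPoint ∈
          invPoints (absoluteGaloisGroup K) (T m k hk).pointsSubgroup ((p ^ M : ℕ) : ℤ)) ∧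
      (∀ (k : ℕ) (hk : k ∣ lev m), ∀ v : HeightOneSpectrum (𝓞 K), (k : 𝓞 K) ∉ v.asIdeal →
        ∀ 𝔐 ∈ v.localPrimesAbove, ∀ t ∈ 𝔐.inertia (absoluteGaloisGroup (v.adicCompletion K)),
          resGal (K := K) (v.adicCompletion K) t • (T m k hk).toGeomPoints (T m k hk).derivedPoint =
            (T m k hk).toGeomPoints (T m k hk).derivedPoint) := by
    intro m
    have hn := (hlev m).1
    choose σ H f yy π j e hord hj hπρ hfsec hHρ hdict hjunk using
      fun k ↦ KolyvaginH44.exists_levelData (W := W) (Dt := Dt) (β := β) hK ι hn (hinert m) (T m) k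
    letI hcg : ∀ k, CommGroup (ringClassGal ι k) := fun k ↦ { mul_comm := fun a b ↦
      (KolyvaginH44.isMulCommutative_ringClassGal' hK ι k).is_comm.comm a b }
    haveI hfin : ∀ k, Finite (ringClassGal ι k) := KolyvaginH44.finite_ringClassGal hK ι
    letI act : ∀ k, DistribMulAction (ringClassGal ι k)
        ((W.baseChange (ringClassField K ι k)).toAffine.Point) := fun k ↦
      DistribMulAction.compHom _ ((pointGalHom W _).comp (ringClassGal ι k).subtype)
    letI hft : ∀ k, Fintype (ringClassGal ι k ⧸ H k) := fun k ↦ Fintype.ofFinite _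
    have hsmul : ∀ (k) (g : ringClassGal ι k)
        (Q : (W.baseChange (ringClassField K ι k)).toAffine.Point), g • Q =
        pointGalHom W _ (g : ringClassField K ι k ≃ₐ[ℚ] ringClassField K ι k) Q := fun _ _ _ ↦ rfl
    set ρ : ∀ k, ringClassGal ι k →* (ringClassField K ι k ≃ₐ[ℚ] ringClassField K ι k) :=
      fun k ↦ (ringClassGal ι k).subtype with hρdef
    have hρi : ∀ k, Function.Injective (ρ k) := fun k ↦ (ringClassGal ι k).subtype_injective
    have hj' : ∀ (k) (g : absoluteGaloisGroup K)
        (a : (W.baseChange (ringClassField K ι k)).toAffine.Point),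
        j k (π k g • a) = g • j k a := fun k g a ↦ by rw [hsmul]; exact hj k g a
    have hπρ' : ∀ (k) (τ : absoluteGaloisGroup K) (x : ringClassField K ι k),
        τ • e k x = e k (ρ k (π k τ) x) := fun k τ x ↦ hπρ k τ x
    -- G1: the abstract Kolyvagin point IS `P(k)` at the divisors (x11b3-p8)
    have hP : ∀ (k) (hk : k ∣ lev m),
        j k (kolyvaginPoint (σ k) k.primeFactors (f k) (yy k)) =
          (T m k hk).toGeomPoints (T m k hk).derivedPoint := by
      intro k hk
      obtain ⟨hjk, hyk, hσk, hfS⟩ := hdict k hk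
      rw [hjk, hyk]
      congr 1
      have hbij := KolyvaginH37Bridge.bijOn_of_section_of_transversal (ρ k) (hρi k)
        (H := H k) (Γ := ringClassGal ι k) (G₁ := ringClassGalOver ι k 1) (hHρ k)
        (S := ((T m k hk).S : Set _)) (fun s hs ↦ (T m k hk).S_subset s hs)
        (fun s hs ↦ ⟨⟨s, (T m k hk).S_subset s hs⟩, rfl⟩) (T m k hk).S_transversal (f k) (hfsec k)
        hfS
      exact KolyvaginH37Bridge.map_kolyvaginPoint_eq_derivedPoint
        (pointGalHom W (ringClassField K ι k)) (ρ k) (AddMonoidHom.id _) (fun g a ↦ hsmul k g a)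
        (hn.squarefree_of_dvd hk) hσk (f k) hbij (T m k hk).y
    have hyA := fun (k : ℕ) (hk : k ∣ lev m) ↦ (hdict k hk).2.1
    have hσA := fun (k : ℕ) (hk : k ∣ lev m) ↦ (hdict k hk).2.2.1
    refine ⟨fun k hk ↦ ?_, fun k hk w hkw 𝔐 h𝔐 t ht ↦ ?_⟩
    · have h := KolyvaginH44.kolyvaginPoint_mem_invPoints_of_dvd hK ι Dt hp hM hND hD hn
        (hKolT m) (T m) σ (fun k ↦ k.primeFactors) H f yy π j hj' ρ hρi (fun _ ↦ AddEquiv.refl _)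
        (fun k _ g a ↦ hsmul k g a) hyA hσA (fun _ _ ↦ rfl) (fun k _ ↦ hfsec k) (fun k _ ↦ hHρ k)
        k hk
      rwa [hP k hk, (hdict k hk).1] at h
    · exact hP k hk ▸ KolyvaginH44.smul_kolyvaginPoint_eq_of_mem_localInertia (W := W) hK ι σ
        (fun k ↦ k.primeFactors) H f yy π j hj' e ρ hρi hπρ' k w hkw 𝔐 h𝔐 t ht
  -- the concrete classes of the per-level data are McCallum's classes of `P(lev m)` (any `hdiv`)
  have hcl : ∀ m : ℕ,
      kolyvaginClass (W.baseChange K) ((p ^ M : ℕ) : ℤ) hdiv (hA m (lev m) dvd_rfl)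
          ((T m (lev m) dvd_rfl).toGeomPoints (T m (lev m) dvd_rfl).derivedPoint)
          ((hPtI m).1 (lev m) dvd_rfl) =
        (T m (lev m) dvd_rfl).kolyvaginClass hp M := fun m ↦ by
    rw [KolyvaginHeegnerData.kolyvaginClass_of_admissible _ hp M (hA m _ dvd_rfl)
      ((hPtI m).1 _ dvd_rfl)]
  -- same-level choice independence up to a unit (B2, x11b3-p2 GEN 12), across a level cast
  have hB2 : ∀ (m₀ k : ℕ) (hk : k ∣ lev m₀) (k' : ℕ), k' = k →
      ∀ (d' : KolyvaginHeegnerData Dt β ι k')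
        (H : AddSubgroup (galH1Torsion (W.baseChange K) ((p ^ M : ℕ) : ℤ))) (t : ℤ),
        t • d'.kolyvaginClass hp M ∈ H ↔ t • (T m₀ k hk).kolyvaginClass hp M ∈ H := by
    intro m₀ k hk k' hkk' d' H t; subst k'
    exact KolyvaginChoice.zsmul_kolyvaginClass_mem_iff hK ι Dt hp hM hND hD (hlev m₀).1 (hKolT m₀)
      (T m₀) hk d' (hA m₀ k hk) H t
  have hc1' : ∀ (k : ℕ), k = 1 → ∀ d : KolyvaginHeegnerData Dt β ι k,
      d.toGeomPoints d.derivedPoint = toGeomPoints (W.baseChange K) P := by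
    rintro _ rfl d; exact hc1 d
  -- ASSEMBLY: `ε := −w(E)`, `τ := liftAut c`, `A m := E(K[lev m])`, `P_m := P(lev m)`
  refine ⟨-W.rootNumber, liftAut c, isLiftOfAut_liftAut c,
    fun m ↦ (T m (lev m) dvd_rfl).pointsSubgroup, fun m ↦ hA m (lev m) dvd_rfl,
    fun m ↦ (T m (lev m) dvd_rfl).toGeomPoints (T m (lev m) dvd_rfl).derivedPoint,
    fun m ↦ (hPtI m).1 (lev m) dvd_rfl, ?_, ?_, ?_, ?_, ?_⟩
  · rcases W.rootNumber_eq_one_or with h | h -- (a) the sign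
    · exact Or.inr (by rw [h])
    · exact Or.inl (by rw [h, neg_neg])
  · exact isOfFinAddOrder_map_sub_of_eq_conductorNorm hN hK hH hHP c hc -- (a) Darmon Prop. 3.11
  · exact fun m ↦ RingClassConj.pointsMap_mem_pointsSubgroup hK (hlev0 m) (T m (lev m) dvd_rfl)
      (isLiftOfAut_liftAut c) -- (b) `τ`-stability of every `E(K[lev m])` (x11b3-p8)
  · exact hc1' (lev 1) (hlev_eq 1 hKol1) _ -- (c) `P_1 = y_K` (x11b3-p1, modulo `hrec`)
  · -- (d), (e), (f) at a Kolyvagin level `m` (so `lev m = m`)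
    intro m hmsq hmkol
    have hlm : lev m = m := hlev_eq m ⟨hmsq, hmkol⟩
    refine ⟨?_, ?_, ?_, ?_⟩
    · -- (d) Gross Prop. 5.4 (1) (x11b3-p2 p301428), modulo (A′-53) at `ε = −w(E)`
      obtain ⟨B, hB, hBeq⟩ := KolyvaginTauEigen.pointsMap_derivedPoint_concrete_of_prop53 hK ι hp hM
        Dt hND hD (hlev m).1 (hKolT m) (T m) hc (isLiftOfAut_liftAut c) (-W.rootNumber)
        (h53 hK hH Dt β ι hM (hlev m).1 (hKolT m) (T m)) (hA m) (lev m) dvd_rfl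
      have hpf : (lev m).primeFactors = m.primeFactors := by rw [hlm]
      exact ⟨B, hB, by rwa [hpf] at hBeq⟩
    · -- (e) Gross Prop. 6.2 (1) / McCallum L4.3 at `v ∤ m` (x11b3-p2 p299176), mod [GZ86 III (3.1)]
      intro v hv
      obtain ⟨n', hcop, hGZ'⟩ := hGZ hK hH Dt β ι hM (hlev m).1 (hKolT m) (T m)
      have hv' : ((lev m : ℕ) : 𝓞 K) ∉ v.asIdeal := by rw [hlm]; exact hv
      have h := KolyvaginHloc.hloc_concrete_of_GZ31 hK ι hp hM Dt hND hD (hlev m).1 (hKolT m) (T m)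
        hcop hGZ' (hA m) (lev m) dvd_rfl v hv'
      rwa [← hcl m] at h
    · -- (f) McCallum Prop. 4.4 at `λ ∣ m` (p292923) mod (γ), inside `T m`; then B2 to `D (m/ℓ)`
      intro ℓ hℓ hℓm v hv a
      have hℓlm : ℓ ∣ lev m := by rw [hlm]; exact hℓm
      have hKol' : Kol (m / ℓ) := hKdiv m (m / ℓ) (by rw [hlm]; exact Nat.div_dvd_of_dvd hℓm)
      have hlev' : lev (m / ℓ) = lev m / ℓ := by rw [hlev_eq _ hKol', hlm]
      have h44 := KolyvaginH44.h44_concrete_of_traceRelation_of_congruence hK ι hHP hp hp2 hM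
        (W.exists_weilPairing_holds p) Dt hND hD (hlev m).1 (hKolT m) (T m) (hTcoh m)
        (hγ hK hH Dt β ι hM (hlev m).1 (hKolT m) (T m)) (hA m) (hPtI m).1 (hPtI m).2
        (lev m) dvd_rfl ℓ hℓ hℓlm v hv a
      rw [hcl m, hcl (m / ℓ), h44]
      exact (hB2 m (lev m / ℓ) ((Nat.div_dvd_of_dvd hℓlm).trans dvd_rfl) (lev (m / ℓ)) hlev'
        (T (m / ℓ) (lev (m / ℓ)) dvd_rfl) _ _).symm
    · -- (g) global divisibility to depth `t`: McCallum's class of the top datum is killed by `p^{M−t}`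
      rw [hcl m]
      exact hDivT hK hH Dt β ι hM (hlev m).1 (hKolT m) (T m)

end Summit.BirchSwinnertonDyer.Rank1Residual.X11b.KolyvaginAssembly

end
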